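import Summits.ValiantsHypothesis.ValiantsHypothesis.Theorems.LangWeilTransferTameResolutionAssemblyPrelims
import Summits.ValiantsHypothesis.ValiantsHypothesis.Theorems.LangWeilTransferTameResolutionFlatSizes
import Mathlib.RingTheory.Polynomial.IntegralNormalization
import Mathlib.RingTheory.Polynomial.ScaleRoots

/-!
# LangWeilTransfer, support item `TameResolution` (stmt-ValiantsHypothesis-6378) — making the
# hypersurface model MONIC without Noether position (`integralNormalization` / `scaleRoots`)

Route `LangWeilTransfer` of `ValiantsHypothesis` (conditional route; honest framing: bookkeeping,
nothing here bears on VP ≠ VNP, which is NOT proved). Step (2) of the Noether-free quantitative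
assembly of `TameResolution` (val-width-6373-p2 g2): the Kronecker parametrisation over an
arbitrary transcendence basis `T̄` (`exists_parametrisation_generic`) yields `Q ∈ ℤ[T][U]`
irreducible over `ℚ` with a leading `U`-coefficient `κ(T) ≠ 0` that need not be constant,
`ρ ∈ ℤ[T] ∖ 0` and numerators `V_j` with `ξ_j ρ(T̄) = V_j(T̄, u)`. Replacing the primitive element
`u` by `κ(T̄) · u`:

* `Q♮ := integralNormalization Q` is monic, `Q♮(T̄, κ(T̄) u) = κ(T̄)^{D-1} Q(T̄, u) = 0`
  (Mathlib), and — the one algebraic point — `Q♮` is again IRREDUCIBLE over `ℚ`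
  (`irreducible_integralNormalization`: a prime `p` of positive degree over a domain has
  irreducible integral normalisation, by `p♮(κ U) = κ^{D-1} p(U)` and a degree count);
* `ρ♮ := ρ κ^M` and `V♮_j := C(κ^{M - deg V_j}) · scaleRoots V_j κ` satisfy
  `ξ_j ρ♮(T̄) = V♮_j(T̄, κ(T̄) u)` (`scaleRoots_eval₂_mul`);
* the coefficient degrees / weights of `Q♮`, `ρ♮`, `V♮_j` are bounded polynomially in those of
  `Q`, `ρ`, `V_j` (`…_sizes` lemmas), so the envelope of `TameResolution` is unaffected.

This removes the integer Noether-normalisation loop (and its height bookkeeping) from the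
quantitative pass.
-/

noncomputable section

open MvPolynomial
open Literature.Computability.AlgebraicComplexity (weight)

-- the summit and the problem share the name `ValiantsHypothesis` (D-0017 single-conjunct layout)
set_option linter.dupNamespace false

namespace Summit.ValiantsHypothesis.ValiantsHypothesis.Theorems.LangWeilTransfer

/-! ## Irreducibility of the integral normalisation -/

section Irreducible

variable {R : Type*} [CommRing R]

/-- `p♮(κ U) = κ^{D-1} · p(U)` as polynomials, `κ` the leading coefficient, `D ≥ 1` the degree. -/
theorem integralNormalization_comp_C_mul_X (p : Polynomial R) (hp : 1 ≤ p.natDegree) :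
    (Polynomial.integralNormalization p).comp (Polynomial.C p.leadingCoeff * Polynomial.X) =
      Polynomial.C p.leadingCoeff ^ (p.natDegree - 1) * p := by
  rw [Polynomial.comp, Polynomial.integralNormalization_eval₂_leadingCoeff_mul hp, Polynomial.eval₂_C_X]

/-- **A prime polynomial of positive degree over a domain has irreducible integral
normalisation.** If `p♮ = A · B` with `deg A, deg B ≥ 1`, then `A(κU) · B(κU) = κ^{D-1} p`, so
`p ∣ A(κU)` (say), a non-zero polynomial of degree `deg A < D` — impossible; and a factor of
degree `0` divides the leading coefficient `1`. -/
theorem irreducible_integralNormalization [IsDomain R] {p : Polynomial R} (hp : Prime p) (hdeg : 0 < p.natDegree) :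
    Irreducible (Polynomial.integralNormalization p) := by
  have hp0 : p ≠ 0 := hp.ne_zero
  have hmonic := Polynomial.monic_integralNormalization hp0
  set κ := p.leadingCoeff with hκ
  have hκ0 : κ ≠ 0 := Polynomial.leadingCoeff_ne_zero.2 hp0
  have hdegN : (Polynomial.integralNormalization p).natDegree = p.natDegree :=
    Polynomial.natDegree_integralNormalization
  refine ⟨fun hu => ?_, fun A B hAB => ?_⟩
  · rw [hmonic.isUnit_iff] at hu
    rw [hu, Polynomial.natDegree_one] at hdegN
    omega
  · -- degrees of the factors
    have hA0 : A ≠ 0 := by rintro rfl; rw [zero_mul] at hAB; exact hmonic.ne_zero hAB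
    have hB0 : B ≠ 0 := by rintro rfl; rw [mul_zero] at hAB; exact hmonic.ne_zero hAB
    have hsum : A.natDegree + B.natDegree = p.natDegree := by
      rw [← hdegN, hAB, Polynomial.natDegree_mul hA0 hB0]
    have hlc : A.leadingCoeff * B.leadingCoeff = 1 := by
      rw [← Polynomial.leadingCoeff_mul, ← hAB]; exact hmonic.leadingCoeff
    -- a factor of degree `0` is a unit
    by_cases hA : A.natDegree = 0
    · left
      obtain ⟨a₀, ha₀⟩ := Polynomial.natDegree_eq_zero.1 hA
      rw [← ha₀]
      refine Polynomial.isUnit_C.2 (IsUnit.of_mul_eq_one B.leadingCoeff ?_)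
      rw [← ha₀, Polynomial.leadingCoeff_C] at hlc; exact hlc
    by_cases hB : B.natDegree = 0
    · right
      obtain ⟨b₀, hb₀⟩ := Polynomial.natDegree_eq_zero.1 hB
      rw [← hb₀]
      refine Polynomial.isUnit_C.2 (IsUnit.of_mul_eq_one A.leadingCoeff ?_)
      rw [← hb₀, Polynomial.leadingCoeff_C, mul_comm] at hlc; exact hlc
    -- both factors of positive degree: contradiction
    exfalso
    set L := Polynomial.C κ * Polynomial.X with hL
    have hLdeg : L.natDegree = 1 := Polynomial.natDegree_C_mul_X κ hκ0
    have hcomp : A.comp L * B.comp L = Polynomial.C κ ^ (p.natDegree - 1) * p := by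
      rw [← Polynomial.mul_comp, ← hAB, hL]
      exact integralNormalization_comp_C_mul_X p hdeg
    have hdvd : p ∣ A.comp L * B.comp L := by rw [hcomp]; exact dvd_mul_left p _
    have hAL : (A.comp L).natDegree = A.natDegree := by rw [Polynomial.natDegree_comp, hLdeg, mul_one]
    have hBL : (B.comp L).natDegree = B.natDegree := by rw [Polynomial.natDegree_comp, hLdeg, mul_one]
    have hAL0 : A.comp L ≠ 0 := fun h => hA (by rw [← hAL, h, Polynomial.natDegree_zero])
    have hBL0 : B.comp L ≠ 0 := fun h => hB (by rw [← hBL, h, Polynomial.natDegree_zero])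
    rcases hp.dvd_or_dvd hdvd with h | h
    · have := Polynomial.natDegree_le_of_dvd h hAL0
      rw [hAL] at this
      omega
    · have := Polynomial.natDegree_le_of_dvd h hBL0
      rw [hBL] at this
      omega

end Irreducible

/-! ## The normalised model over `ℚ`: irreducibility in `ℚ[X₀, …, X_r]` -/

variable {r : ℕ}

/-- The integral normalisation commutes with `ℤ[T][U] → ℚ[T][U]`. -/
theorem integralNormalization_map_int_rat (Q : Polynomial (MvPolynomial (Fin r) ℤ)) :
    (Polynomial.integralNormalization Q).map (MvPolynomial.map (Int.castRingHom ℚ)) =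
      Polynomial.integralNormalization (Q.map (MvPolynomial.map (Int.castRingHom ℚ))) := by
  by_cases hQ : Q = 0
  · rw [hQ, Polynomial.integralNormalization_zero, Polynomial.map_zero, Polynomial.integralNormalization_zero]
  · rw [Polynomial.integralNormalization_map]
    rw [Ne, map_eq_zero_iff _ (MvPolynomial.map_injective _ (RingHom.injective_int (Int.castRingHom ℚ)))]
    exact Polynomial.leadingCoeff_ne_zero.2 hQ

/-- **The normalised model is irreducible over `ℚ`.** For `Q ∈ ℤ[T][U]` of positive `U`-degree
with `Q ⊗ ℚ` irreducible in `ℚ[T][U]`, the flattened integral normalisation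
`(finSuccEquiv ℤ r)⁻¹ (integralNormalization Q) ⊗ ℚ` is irreducible in `ℚ[X₀, …, X_r]`. -/
theorem irreducible_map_finSuccEquiv_symm_integralNormalization (Q : Polynomial (MvPolynomial (Fin r) ℤ))
    (hQ : Irreducible (Q.map (MvPolynomial.map (Int.castRingHom ℚ)))) (hdeg : 0 < Q.natDegree) :
    Irreducible (MvPolynomial.map (Int.castRingHom ℚ)
      ((finSuccEquiv ℤ r).symm (Polynomial.integralNormalization Q))) := by
  refine irreducible_map_finSuccEquiv_symm _ ?_
  rw [integralNormalization_map_int_rat]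
  have hprime : Prime (Q.map (MvPolynomial.map (Int.castRingHom ℚ))) :=
    UniqueFactorizationMonoid.irreducible_iff_prime.1 hQ
  refine irreducible_integralNormalization hprime ?_
  rwa [Polynomial.natDegree_map_eq_of_injective
    (MvPolynomial.map_injective _ (RingHom.injective_int (Int.castRingHom ℚ)))]

/-- The normalised model is monic: leading `U`-coefficient `C 1`. -/
theorem leadingCoeff_finSuccEquiv_integralNormalization (Q : Polynomial (MvPolynomial (Fin r) ℤ))
    (hQ : Q ≠ 0) :
    (finSuccEquiv ℤ r ((finSuccEquiv ℤ r).symm (Polynomial.integralNormalization Q))).leadingCoeff =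
      C (1 : ℤ) := by
  rw [AlgEquiv.apply_symm_apply, (Polynomial.monic_integralNormalization hQ).leadingCoeff, C_1]

/-- The normalised model has the same (positive) `U`-degree. -/
theorem natDegree_finSuccEquiv_integralNormalization (Q : Polynomial (MvPolynomial (Fin r) ℤ)) :
    (finSuccEquiv ℤ r ((finSuccEquiv ℤ r).symm (Polynomial.integralNormalization Q))).natDegree =
      Q.natDegree := by
  rw [AlgEquiv.apply_symm_apply, Polynomial.natDegree_integralNormalization]

/-! ## Evaluations: the root `κ(T̄) u` and the rescaled graph relations -/

section Eval

variable {F₀ : Type*} [CommRing F₀]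

/-- `Q♮(T̄, κ(T̄) u) = 0` whenever `Q(T̄, u) = 0` and `θ : ℤ[T] → F₀` is injective. -/
theorem eval_integralNormalization_eq_zero (θ : MvPolynomial (Fin r) ℤ →+* F₀) (hθ : Function.Injective θ)
    (Q : Polynomial (MvPolynomial (Fin r) ℤ)) {u : F₀} (hu : (Q.map θ).eval u = 0) :
    ((Polynomial.integralNormalization Q).map θ).eval (θ Q.leadingCoeff * u) = 0 := by
  rw [Polynomial.eval_map] at hu ⊢
  exact Polynomial.integralNormalization_eval₂_eq_zero θ hu fun x hx => hθ (by rw [hx, map_zero])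

/-- **Rescaled graph relation.** If `ξ · θ ρ = V(T̄, u)` and `deg_U V ≤ M`, then with
`ρ♮ = ρ κ^M`, `V♮ = C(κ^{M - deg V}) · scaleRoots V κ` one has `ξ · θ ρ♮ = V♮(T̄, κ(T̄) u)`. -/
theorem eval_scaleRoots_graph (θ : MvPolynomial (Fin r) ℤ →+* F₀) (κ ρ : MvPolynomial (Fin r) ℤ)
    (V : Polynomial (MvPolynomial (Fin r) ℤ)) {M : ℕ} (hM : V.natDegree ≤ M) {ξ u : F₀}
    (h : ξ * θ ρ = (V.map θ).eval u) :
    ξ * θ (ρ * κ ^ M) =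
      ((Polynomial.C (κ ^ (M - V.natDegree)) * Polynomial.scaleRoots V κ).map θ).eval (θ κ * u) := by
  rw [Polynomial.map_mul, Polynomial.map_C, Polynomial.eval_mul, Polynomial.eval_C, Polynomial.eval_map,
    Polynomial.scaleRoots_eval₂_mul, ← Polynomial.eval_map, ← h, map_mul, map_pow, map_pow]
  have hM' : M = (M - V.natDegree) + V.natDegree := (Nat.sub_add_cancel hM).symm
  conv_lhs => rw [hM', pow_add]
  ring

end Eval

/-! ## Sizes of the normalised data -/

/-- Coefficients of `Q♮`: `Q♮_i = Q_i κ^{D-1-i}` (`i < D`), `Q♮_D = 1`. Degrees `≤ N · Dc` and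
weights `≤ W^N` if `deg_U Q ≤ N`, every coefficient of `Q` has total degree `≤ Dc` and weight `≤ W`
(`W ≥ 1`). -/
theorem integralNormalization_coeff_sizes (Q : Polynomial (MvPolynomial (Fin r) ℤ)) {N Dc W : ℕ}
    (hN : Q.natDegree ≤ N) (hN1 : 1 ≤ N) (hDc : ∀ i, (Q.coeff i).totalDegree ≤ Dc) (hW1 : 1 ≤ W)
    (hW : ∀ i, weight (Q.coeff i) ≤ W) (i : ℕ) :
    ((Polynomial.integralNormalization Q).coeff i).totalDegree ≤ N * Dc ∧
      weight ((Polynomial.integralNormalization Q).coeff i) ≤ W ^ N := by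
  rw [Polynomial.integralNormalization_coeff]
  split_ifs with h
  · rw [totalDegree_one, Literature.Computability.AlgebraicComplexity.weight_one]
    exact ⟨Nat.zero_le _, Nat.one_le_pow _ _ hW1⟩
  · constructor
    · refine (totalDegree_mul _ _).trans ?_
      refine (Nat.add_le_add (hDc i) ((totalDegree_pow _ _).trans (Nat.mul_le_mul_left _ (hDc _)))).trans ?_
      have h1 : Q.natDegree - 1 - i ≤ N - 1 := by omega
      calc Dc + (Q.natDegree - 1 - i) * Dc ≤ Dc + (N - 1) * Dc := by
            exact Nat.add_le_add_left (Nat.mul_le_mul_right _ h1) _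
        _ = N * Dc := by
            have : N = (N - 1) + 1 := (Nat.sub_add_cancel hN1).symm
            conv_rhs => rw [this]
            ring
    · refine (Literature.Computability.AlgebraicComplexity.weight_mul_le _ _).trans ?_
      refine (Nat.mul_le_mul (hW i)
        ((Literature.Computability.AlgebraicComplexity.weight_pow_le _ _).trans
          (Nat.pow_le_pow_left (hW _) _))).trans ?_
      rw [← pow_succ']
      exact Nat.pow_le_pow_right hW1 (by omega)

/-- Coefficients of `V♮ = C(κ^{M - deg V}) · scaleRoots V κ`: `V♮_i = κ^{M-i} V_i` for
`i ≤ deg V ≤ M`. Degrees `≤ DV + M · Dκ`, weights `≤ WV · Wκ^M` (`Wκ ≥ 1`). -/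
theorem scaleRoots_coeff_sizes (κ : MvPolynomial (Fin r) ℤ) (V : Polynomial (MvPolynomial (Fin r) ℤ))
    {M Dκ DV Wκ WV : ℕ} (hM : V.natDegree ≤ M) (hDκ : κ.totalDegree ≤ Dκ) (hDV : ∀ i, (V.coeff i).totalDegree ≤ DV)
    (hWκ1 : 1 ≤ Wκ) (hWκ : weight κ ≤ Wκ) (hWV : ∀ i, weight (V.coeff i) ≤ WV) (i : ℕ) :
    ((Polynomial.C (κ ^ (M - V.natDegree)) * Polynomial.scaleRoots V κ).coeff i).totalDegree ≤ DV + M * Dκ ∧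
      weight ((Polynomial.C (κ ^ (M - V.natDegree)) * Polynomial.scaleRoots V κ).coeff i) ≤ WV * Wκ ^ M := by
  rw [Polynomial.coeff_C_mul, Polynomial.coeff_scaleRoots]
  have hexp : (M - V.natDegree) + (V.natDegree - i) ≤ M := by omega
  have hrw : κ ^ (M - V.natDegree) * (V.coeff i * κ ^ (V.natDegree - i)) =
      V.coeff i * κ ^ ((M - V.natDegree) + (V.natDegree - i)) := by rw [pow_add]; ring
  rw [hrw]
  constructor
  · refine (totalDegree_mul _ _).trans (Nat.add_le_add (hDV i) ?_)
    refine (totalDegree_pow _ _).trans ?_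
    exact Nat.mul_le_mul hexp hDκ
  · refine (Literature.Computability.AlgebraicComplexity.weight_mul_le _ _).trans (Nat.mul_le_mul (hWV i) ?_)
    refine (Literature.Computability.AlgebraicComplexity.weight_pow_le _ _).trans ?_
    exact (Nat.pow_le_pow_left hWκ _).trans (Nat.pow_le_pow_right hWκ1 hexp)

/-- `deg_U` of `V♮` is at most `M`. -/
theorem natDegree_C_mul_scaleRoots_le (κ : MvPolynomial (Fin r) ℤ) (V : Polynomial (MvPolynomial (Fin r) ℤ))
    {M : ℕ} (hM : V.natDegree ≤ M) :
    (Polynomial.C (κ ^ (M - V.natDegree)) * Polynomial.scaleRoots V κ).natDegree ≤ M := by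
  refine (Polynomial.natDegree_C_mul_le _ _).trans ?_
  rw [Polynomial.natDegree_scaleRoots]; exact hM

/-- Sizes of `ρ♮ = ρ κ^M`: degree `≤ Dρ + M · Dκ`, weight `≤ Wρ · Wκ^M`. -/
theorem rho_mul_pow_sizes (κ ρ : MvPolynomial (Fin r) ℤ) {M Dκ Dρ Wκ Wρ : ℕ} (hDκ : κ.totalDegree ≤ Dκ)
    (hDρ : ρ.totalDegree ≤ Dρ) (hWκ : weight κ ≤ Wκ) (hWρ : weight ρ ≤ Wρ) :
    (ρ * κ ^ M).totalDegree ≤ Dρ + M * Dκ ∧ weight (ρ * κ ^ M) ≤ Wρ * Wκ ^ M := by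
  constructor
  · exact (totalDegree_mul _ _).trans
      (Nat.add_le_add hDρ ((totalDegree_pow _ _).trans (Nat.mul_le_mul_left _ hDκ)))
  · exact (Literature.Computability.AlgebraicComplexity.weight_mul_le _ _).trans
      (Nat.mul_le_mul hWρ ((Literature.Computability.AlgebraicComplexity.weight_pow_le _ _).trans
        (Nat.pow_le_pow_left hWκ _)))

/-- The leading coefficient is one of the coefficients: its degree and weight are bounded by any
uniform coefficient bound. -/
theorem leadingCoeff_sizes (Q : Polynomial (MvPolynomial (Fin r) ℤ)) {Dc W : ℕ}
    (hDc : ∀ i, (Q.coeff i).totalDegree ≤ Dc) (hW : ∀ i, weight (Q.coeff i) ≤ W) :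
    Q.leadingCoeff.totalDegree ≤ Dc ∧ weight Q.leadingCoeff ≤ W :=
  ⟨hDc _, hW _⟩

/-- A non-zero integer polynomial has weight `≥ 1`. -/
theorem one_le_weight_of_ne_zero {σ : Type*} (f : MvPolynomial σ ℤ) (hf : f ≠ 0) : 1 ≤ weight f := by
  rw [Nat.one_le_iff_ne_zero, Ne, weight_eq_zero_iff]
  exact hf

end Summit.ValiantsHypothesis.ValiantsHypothesis.Theorems.LangWeilTransfer

end
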